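import Mathlib.Data.ZMod.Basic
import Mathlib.Data.Fintype.BigOperators
import Mathlib.Algebra.BigOperators.Ring.Finset
import Mathlib.Tactic.Ring
import Mathlib.Tactic.Positivity
import HarnessLib

/-!
# Sipser's Coding Lemma: isolating hash families exist iff the set is small

Trunk `CplxCore`. The combinatorial core of the hashing technique by which sizes of sets of
strings are estimated inside the polynomial hierarchy (Sipser 1983; used by
Han–Hemaspaandra–Thierauf 1997, §3, to place `BPP_path = PostBPP` in `P^{Σ₂ᵖ[log]}`, and by
Stockmeyer 1985 for approximate counting). For a set `X ⊆ {0,1}^M` of Boolean vectors and a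
collection `H₁, …, H_k` of `k × M` matrices over `GF(2)` (HHT 1997, Def. 3.8):

* `Separates X H` — every `y ∈ X` is *isolated* by some `Hᵢ`: `Hᵢ z ≠ Hᵢ y` for all
  `z ∈ X ∖ {y}` (`Isolates`), where `Hᵢ y ∈ GF(2)^k` is the matrix–vector product (`hashVal`,
  rows `dotZ`);
* `Hashable X k` — some collection of `k` such matrices separates `X` (`Hash_X(k)`).

Main results (both directions of HHT 1997, Cor. 3.10, the first in the counting form that
underlies Lemma 3.9):

* `hashable_of_card_le` — **if `2·|X| ≤ 2^k` then `Hash_X(k)`**: the collections failing to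
  separate `X` are fewer than all collections. For `y ≠ z` exactly half of the rows `r` have
  `⟨r, y⟩ = ⟨r, z⟩` (an involution flipping one coordinate where `y` and `z` differ,
  `two_mul_card_filter_dotZ_eq`), so the matrices confusing `y` with `z` are a `2^{-k}` fraction,
  those confusing `y` with some other member of `X` at most `(|X| - 1)·2^{-k}`, the collections all
  of whose members confuse `y` at most the `k`-th power of that, and summing over `y ∈ X` the bad
  collections are at most `|X|·(|X|-1)^k·2^{-k²} < 1` of all (`key_ineq`);
* `card_le_of_hashable` — **if `Hash_X(k)` then `|X| ≤ k·2^k`** (pigeonhole: `Hᵢ` is injective on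
  the members it isolates);
* `separates_iff_forall` — the `∃ i ∀ z` in `Separate` skolemised into `∀ (z₁,…,z_k) ∃ i`, the form
  in which `Hash_X(k) = ∃ H ∀ …` is a `Σ₂ᵖ` predicate with a polynomial-time matrix (HHT 1997,
  proof of Thm. 3.11: "Separate is a coNP predicate … and Hash is a Σ₂ᵖ predicate");
* `hashVal_ne_iff` — `H z ≠ H y` iff some row has odd overlap with the positions where `z` and
  `y` differ (the parity test a machine performs).

## References

* M. Sipser, *A complexity theoretic approach to randomness*, Proc. 15th STOC (1983) 330–335
  (Coding Lemma).
* Y. Han, L. A. Hemaspaandra, T. Thierauf, *Threshold computation and cryptographic security*,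
  SIAM J. Comput. 26 (1997) 59–78, Def. 3.8, Lemma 3.9, Cor. 3.10.
* L. J. Stockmeyer, *On approximation algorithms for #P*, SIAM J. Comput. 14 (1985) 849–861
  (the pigeonhole upper bound, cited by HHT for Cor. 3.10).
-/

namespace Literature.Computability.Complexity

open Finset

namespace SipserHash

variable {M k : ℕ}

/-! ### Hash values over `GF(2)` -/

/-- The `GF(2)` inner product `⟨r, y⟩ = Σ_c r_c y_c (mod 2)` of two Boolean vectors.
[HHT 1997, Def. 3.8 ("arithmetic done in GF[2]")] [cite: HanHemaspaandraThierauf1997, Def. 3.8] -/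
def dotZ (r y : Fin M → Bool) : ZMod 2 := ∑ c, if r c && y c then 1 else 0

/-- The hash value `H y ∈ GF(2)^k` of `y` under the `k × M` matrix `H` (rows `H ρ`): the vector of
row products. [HHT 1997, Def. 3.8 ("multiplication of the `k × m` matrix `Hᵢ` with the `m` vector
`y`")] [cite: HanHemaspaandraThierauf1997, Def. 3.8] -/
def hashVal (H : Fin k → Fin M → Bool) (y : Fin M → Bool) : Fin k → ZMod 2 := fun ρ => dotZ (H ρ) y

/-- `y` is isolated within `X` by the matrix `H`: no other member of `X` has the same hash value.
[HHT 1997, Def. 3.8 (1)] [cite: HanHemaspaandraThierauf1997, Def. 3.8] -/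
def Isolates (X : Finset (Fin M → Bool)) (H : Fin k → Fin M → Bool) (y : Fin M → Bool) : Prop :=
  ∀ z ∈ X, z ≠ y → hashVal H z ≠ hashVal H y

/-- **`Separate_X(H₁, …, H_k)`**: every member of `X` is isolated by some matrix of the collection.
[HHT 1997, Def. 3.8 (1)] [cite: HanHemaspaandraThierauf1997, Def. 3.8] -/
def Separates (X : Finset (Fin M → Bool)) (H : Fin k → Fin k → Fin M → Bool) : Prop :=
  ∀ y ∈ X, ∃ i, Isolates X (H i) y

/-- **`Hash_X(k)`**: some collection of `k` matrices of format `k × M` separates `X`.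
[HHT 1997, Def. 3.8 (2)] [cite: HanHemaspaandraThierauf1997, Def. 3.8] -/
def Hashable (X : Finset (Fin M → Bool)) (k : ℕ) : Prop :=
  ∃ H : Fin k → Fin k → Fin M → Bool, Separates X H

/-! ### The pigeonhole bound -/

/-- A matrix is injective on the members it isolates, so it isolates at most `2^k` of them.
[Stockmeyer 1985; HHT 1997, Cor. 3.10 ("the upper bound follows by the pigeon hole principle")]
[cite: HanHemaspaandraThierauf1997, Cor. 3.10] -/
theorem card_filter_isolates_le (X : Finset (Fin M → Bool)) (H : Fin k → Fin M → Bool)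
    [DecidablePred (Isolates X H)] : (X.filter (Isolates X H)).card ≤ 2 ^ k := by
  classical
  have hinj : Set.InjOn (hashVal H) (X.filter (Isolates X H) : Set (Fin M → Bool)) := by
    intro y hy z hz heq
    rw [coe_filter, Set.mem_setOf_eq] at hy hz
    by_contra hne
    exact hz.2 y hy.1 hne heq
  calc (X.filter (Isolates X H)).card
      ≤ (univ : Finset (Fin k → ZMod 2)).card :=
        card_le_card_of_injOn (hashVal H) (fun _ _ => mem_univ _) hinj
    _ = 2 ^ k := by simp

/-- **`Hash_X(k)` implies `|X| ≤ k·2^k`.** [HHT 1997, Cor. 3.10 (upper bound, after Stockmeyer 1985)]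
[cite: HanHemaspaandraThierauf1997, Cor. 3.10] -/
theorem card_le_of_separates {X : Finset (Fin M → Bool)} {H : Fin k → Fin k → Fin M → Bool}
    (hS : Separates X H) : X.card ≤ k * 2 ^ k := by
  classical
  have hcov : X ⊆ (univ : Finset (Fin k)).biUnion fun i => X.filter (Isolates X (H i)) := by
    intro y hy
    obtain ⟨i, hi⟩ := hS y hy
    exact mem_biUnion.2 ⟨i, mem_univ _, mem_filter.2 ⟨hy, hi⟩⟩
  calc X.card ≤ ((univ : Finset (Fin k)).biUnion fun i => X.filter (Isolates X (H i))).card :=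
        card_le_card hcov
    _ ≤ ∑ i, (X.filter (Isolates X (H i))).card := card_biUnion_le
    _ ≤ ∑ _i : Fin k, 2 ^ k := sum_le_sum fun i _ => card_filter_isolates_le X (H i)
    _ = k * 2 ^ k := by simp

/-- **`Hash_X(k)` implies `|X| ≤ k·2^k`.** [HHT 1997, Cor. 3.10] [cite: HanHemaspaandraThierauf1997, Cor. 3.10] -/
theorem card_le_of_hashable {X : Finset (Fin M → Bool)} (h : Hashable X k) : X.card ≤ k * 2 ^ k := by
  obtain ⟨H, hH⟩ := h
  exact card_le_of_separates hH

/-! ### Counting the rows that confuse two vectors -/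

/-- Arithmetic in `GF(2)`: `a + 1 = b ↔ a ≠ b`. [folklore] -/
theorem zmod2_add_one_eq_iff (a b : ZMod 2) : a + 1 = b ↔ a ≠ b := by
  revert a b; decide

/-- Arithmetic in `GF(2)`: `a ≠ 0 ↔ a = 1`. [folklore] -/
theorem zmod2_ne_zero_iff (a : ZMod 2) : a ≠ 0 ↔ a = 1 := by
  revert a; decide

/-- Flipping coordinate `c₀` of `r` changes `⟨r, y⟩` by `y_{c₀}`. [folklore] -/
theorem dotZ_update_not (r y : Fin M → Bool) (c₀ : Fin M) :
    dotZ (Function.update r c₀ (!r c₀)) y = dotZ r y + if y c₀ then 1 else 0 := by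
  unfold dotZ
  rw [← add_sum_erase _ _ (mem_univ c₀), ← add_sum_erase _ (fun c => if r c && y c then (1 : ZMod 2) else 0)
    (mem_univ c₀)]
  have hrest : ∑ c ∈ univ.erase c₀, (if Function.update r c₀ (!r c₀) c && y c then (1 : ZMod 2) else 0)
      = ∑ c ∈ univ.erase c₀, (if r c && y c then (1 : ZMod 2) else 0) := by
    refine sum_congr rfl fun c hc => ?_
    rw [Function.update_of_ne (ne_of_mem_erase hc)]
  rw [hrest, Function.update_self]
  generalize (∑ c ∈ univ.erase c₀, (if r c && y c then (1 : ZMod 2) else 0)) = S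
  revert S
  cases r c₀ <;> cases y c₀ <;> decide

/-- **Exactly half of the rows confuse two distinct vectors**: for `y ≠ z`,
`2 · #{r | ⟨r, y⟩ = ⟨r, z⟩} = 2^M` (the involution flipping a coordinate where `y` and `z` differ
exchanges agreeing and disagreeing rows). [Sipser 1983, Coding Lemma (proof); HHT 1997, Lemma 3.9]
[cite: HanHemaspaandraThierauf1997, Lemma 3.9] -/
theorem two_mul_card_filter_dotZ_eq (y z : Fin M → Bool) (hyz : y ≠ z)
    [DecidablePred fun r : Fin M → Bool => dotZ r y = dotZ r z] :
    2 * (univ.filter fun r : Fin M → Bool => dotZ r y = dotZ r z).card = 2 ^ M := by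
  classical
  obtain ⟨c₀, hc₀⟩ : ∃ c₀, y c₀ ≠ z c₀ := Function.ne_iff.1 hyz
  set φ : (Fin M → Bool) → (Fin M → Bool) := fun r => Function.update r c₀ (!r c₀) with hφ
  have hφφ : ∀ r, φ (φ r) = r := by
    intro r
    ext c
    by_cases hc : c = c₀
    · subst hc; simp [hφ]
    · simp [hφ, hc]
  have hflip : ∀ r, (dotZ (φ r) y = dotZ (φ r) z ↔ ¬ dotZ r y = dotZ r z) := by
    intro r
    simp only [hφ]
    rw [dotZ_update_not, dotZ_update_not]
    generalize dotZ r y = a, dotZ r z = b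
    revert a b hc₀
    cases y c₀ <;> cases z c₀ <;> decide
  have himg : (univ.filter fun r : Fin M → Bool => dotZ r y = dotZ r z).image φ =
      univ.filter fun r => ¬ dotZ r y = dotZ r z := by
    ext r
    simp only [mem_image, mem_filter, mem_univ, true_and]
    constructor
    · rintro ⟨r', hr', rfl⟩
      exact fun h => ((hflip r').1 h) hr'
    · intro hr
      exact ⟨φ r, (hflip r).2 hr, hφφ r⟩
  have hinj : Function.Injective φ := fun a b h => by simpa [hφφ] using congr_arg φ h
  have hsum := Finset.card_filter_add_card_filter_not (s := (univ : Finset (Fin M → Bool)))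
    (p := fun r : Fin M → Bool => dotZ r y = dotZ r z)
  rw [← himg, card_image_of_injective _ hinj, card_univ, Fintype.card_fun, Fintype.card_bool,
    Fintype.card_fin] at hsum
  omega

/-! ### Counting the bad collections -/

section Count

open scoped Classical

variable (X : Finset (Fin M → Bool))

/-- The `k × M` matrices giving `y` and `z` the same hash value. [folklore] -/
noncomputable def agreeM (k : ℕ) (y z : Fin M → Bool) : Finset (Fin k → Fin M → Bool) :=
  univ.filter fun H => hashVal H y = hashVal H z

/-- The `k × M` matrices failing to isolate `y` within `X` (confusing it with another member).
[folklore] -/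
noncomputable def confuseM (k : ℕ) (y : Fin M → Bool) : Finset (Fin k → Fin M → Bool) :=
  univ.filter fun H => ¬ Isolates X H y

/-- The collections none of whose matrices isolates `y` within `X`. [folklore] -/
noncomputable def badFam (k : ℕ) (y : Fin M → Bool) : Finset (Fin k → Fin k → Fin M → Bool) :=
  univ.filter fun H => ∀ i, ¬ Isolates X (H i) y

/-- The collections failing to separate `X`. [folklore] -/
noncomputable def badSep (k : ℕ) : Finset (Fin k → Fin k → Fin M → Bool) :=
  univ.filter fun H => ¬ Separates X H

variable {X}

/-- Agreement of hash values is agreement of every row product: a product set. [folklore] -/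
theorem agreeM_eq_piFinset (k : ℕ) (y z : Fin M → Bool) :
    agreeM k y z = Fintype.piFinset fun _ : Fin k => univ.filter fun r : Fin M → Bool => dotZ r y = dotZ r z := by
  ext H
  simp [agreeM, Fintype.mem_piFinset, hashVal, funext_iff]

/-- **The matrices confusing `y ≠ z` are a `2^{-k}` fraction**: `#agree · 2^k = 2^{Mk}`.
[Sipser 1983; HHT 1997, Lemma 3.9 (proof)] [cite: HanHemaspaandraThierauf1997, Lemma 3.9] -/
theorem card_agreeM_mul (k : ℕ) {y z : Fin M → Bool} (hyz : y ≠ z) :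
    (agreeM k y z).card * 2 ^ k = 2 ^ (M * k) := by
  rw [agreeM_eq_piFinset, Fintype.card_piFinset, prod_const, card_univ, Fintype.card_fin, ← mul_pow,
    mul_comm, two_mul_card_filter_dotZ_eq y z hyz, ← pow_mul]

/-- The matrices confusing `y` within `X` confuse it with some `z ∈ X ∖ {y}`. [folklore] -/
theorem confuseM_subset_biUnion (k : ℕ) (y : Fin M → Bool) :
    confuseM X k y ⊆ (X.erase y).biUnion fun z => agreeM k y z := by
  intro H hH
  simp only [confuseM, mem_filter, mem_univ, true_and, Isolates, not_forall, exists_prop, not_not] at hH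
  obtain ⟨z, hzX, hzy, heq⟩ := hH
  exact mem_biUnion.2 ⟨z, mem_erase.2 ⟨hzy, hzX⟩, mem_filter.2 ⟨mem_univ _, heq.symm⟩⟩

/-- **At most `(|X| - 1)·2^{-k}` of the matrices confuse a member `y`**:
`#confuse · 2^k ≤ (|X| - 1)·2^{Mk}`. [HHT 1997, Lemma 3.9 (proof)] [cite: HanHemaspaandraThierauf1997, Lemma 3.9] -/
theorem card_confuseM_mul_le (k : ℕ) {y : Fin M → Bool} (hy : y ∈ X) :
    (confuseM X k y).card * 2 ^ k ≤ (X.card - 1) * 2 ^ (M * k) := by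
  calc (confuseM X k y).card * 2 ^ k
      ≤ (∑ z ∈ X.erase y, (agreeM k y z).card) * 2 ^ k :=
        Nat.mul_le_mul_right _ ((card_le_card (confuseM_subset_biUnion k y)).trans card_biUnion_le)
    _ = ∑ z ∈ X.erase y, (agreeM k y z).card * 2 ^ k := sum_mul _ _ _
    _ = ∑ _z ∈ X.erase y, 2 ^ (M * k) :=
        sum_congr rfl fun z hz => card_agreeM_mul k (Ne.symm (ne_of_mem_erase hz))
    _ = (X.card - 1) * 2 ^ (M * k) := by rw [sum_const, card_erase_of_mem hy, smul_eq_mul]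

/-- The bad collections for `y` are the `k`-fold product of the confusing matrices. [folklore] -/
theorem badFam_eq_piFinset (k : ℕ) (y : Fin M → Bool) :
    badFam X k y = Fintype.piFinset fun _ : Fin k => confuseM X k y := by
  ext H
  simp [badFam, confuseM, Fintype.mem_piFinset]

/-- **The bad collections for a member `y`**: `#bad_y · 2^{k²} ≤ (|X| - 1)^k · 2^{Mk·k}`.
[HHT 1997, Lemma 3.9 (proof)] [cite: HanHemaspaandraThierauf1997, Lemma 3.9] -/
theorem card_badFam_mul_le (k : ℕ) {y : Fin M → Bool} (hy : y ∈ X) :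
    (badFam X k y).card * 2 ^ (k * k) ≤ (X.card - 1) ^ k * (2 ^ (M * k)) ^ k := by
  rw [badFam_eq_piFinset, Fintype.card_piFinset, prod_const, card_univ, Fintype.card_fin, pow_mul,
    ← mul_pow, ← mul_pow]
  exact Nat.pow_le_pow_left (card_confuseM_mul_le k hy) k

/-- A collection failing to separate `X` is bad for some member. [folklore] -/
theorem badSep_subset_biUnion (k : ℕ) : badSep X k ⊆ X.biUnion fun y => badFam X k y := by
  intro H hH
  simp only [badSep, mem_filter, mem_univ, true_and, Separates, not_forall, exists_prop, not_exists] at hH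
  obtain ⟨y, hy, hno⟩ := hH
  exact mem_biUnion.2 ⟨y, hy, mem_filter.2 ⟨mem_univ _, hno⟩⟩

/-- **The collections failing to separate `X`**: `#bad · 2^{k²} ≤ |X|·(|X| - 1)^k·2^{Mk·k}`.
[Sipser 1983, Coding Lemma; HHT 1997, Lemma 3.9] [cite: HanHemaspaandraThierauf1997, Lemma 3.9] -/
theorem card_badSep_mul_le (k : ℕ) :
    (badSep X k).card * 2 ^ (k * k) ≤ X.card * ((X.card - 1) ^ k * (2 ^ (M * k)) ^ k) := by
  calc (badSep X k).card * 2 ^ (k * k)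
      ≤ (∑ y ∈ X, (badFam X k y).card) * 2 ^ (k * k) :=
        Nat.mul_le_mul_right _ ((card_le_card (badSep_subset_biUnion k)).trans card_biUnion_le)
    _ = ∑ y ∈ X, (badFam X k y).card * 2 ^ (k * k) := sum_mul _ _ _
    _ ≤ ∑ _y ∈ X, (X.card - 1) ^ k * (2 ^ (M * k)) ^ k := sum_le_sum fun y hy => card_badFam_mul_le k hy
    _ = X.card * ((X.card - 1) ^ k * (2 ^ (M * k)) ^ k) := by rw [sum_const, smul_eq_mul]

/-- The number of all collections: `(2^{Mk})^k`. [folklore] -/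
theorem card_univ_fam (k : ℕ) :
    (univ : Finset (Fin k → Fin k → Fin M → Bool)).card = (2 ^ (M * k)) ^ k := by
  rw [card_univ, Fintype.card_fun, Fintype.card_fun, Fintype.card_fun, Fintype.card_bool, Fintype.card_fin,
    Fintype.card_fin, ← pow_mul, ← pow_mul, ← pow_mul, mul_assoc]

end Count

/-- The key inequality: `2s ≤ 2^k`, `k ≥ 1` imply `s·(s - 1)^k < 2^{k²}`. [folklore] -/
theorem key_ineq {s k : ℕ} (hk : 1 ≤ k) (hs : 2 * s ≤ 2 ^ k) : s * (s - 1) ^ k < 2 ^ (k * k) := by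
  rcases Nat.eq_zero_or_pos s with rfl | hs0
  · simp
  have h1 : 2 * (s - 1) < 2 ^ k := by omega
  have h2 : (2 * (s - 1)) ^ k < (2 ^ k) ^ k := Nat.pow_lt_pow_left h1 (by omega)
  have h3 : 2 * s * (2 * (s - 1)) ^ k < 2 ^ k * (2 ^ k) ^ k :=
    Nat.mul_lt_mul_of_le_of_lt hs h2 (by positivity)
  have h4 : 2 * s * (2 * (s - 1)) ^ k = 2 ^ k * (2 * (s * (s - 1) ^ k)) := by
    rw [mul_pow]; ring
  rw [h4, ← pow_mul] at h3
  have h5 := Nat.lt_of_mul_lt_mul_left h3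
  omega

/-- **Sipser's Coding Lemma (existence, counting form).** If `2·|X| ≤ 2^k` then some collection of
`k` matrices of format `k × M` separates `X` — indeed the failing collections are fewer than all.
(Sipser 1983; HHT 1997, Lemma 3.9, states the probability bound `≥ 7/8` for random collections
with `k = ⌊log |X|⌋ + 2`; existence is what Cor. 3.10 and Thm. 3.11 use.)
[cite: HanHemaspaandraThierauf1997, Lemma 3.9] [cite: Sipser1983, Coding Lemma] -/
theorem exists_separates (X : Finset (Fin M → Bool)) (hX : 2 * X.card ≤ 2 ^ k) :
    ∃ H : Fin k → Fin k → Fin M → Bool, Separates X H := by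
  classical
  rcases Nat.eq_zero_or_pos k with rfl | hk
  · have hX0 : X = ∅ := by
      rw [← card_eq_zero]
      rw [pow_zero] at hX
      omega
    exact ⟨fun i => i.elim0, by simp [hX0, Separates]⟩
  by_contra hno
  rw [not_exists] at hno
  have hall : badSep X k = univ := by
    refine eq_univ_of_forall fun H => ?_
    simp only [badSep, mem_filter, mem_univ, true_and]
    exact hno H
  have hle := card_badSep_mul_le (X := X) k
  rw [hall, card_univ_fam] at hle
  have hlt : X.card * ((X.card - 1) ^ k * (2 ^ (M * k)) ^ k) < 2 ^ (k * k) * (2 ^ (M * k)) ^ k := by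
    rw [← mul_assoc]
    exact Nat.mul_lt_mul_of_lt_of_le (key_ineq hk hX) le_rfl (by positivity)
  have := hle.trans_lt hlt
  rw [mul_comm] at this
  exact lt_irrefl _ this

/-- **Sipser's Coding Lemma**: `2·|X| ≤ 2^k` implies `Hash_X(k)`. [cite: HanHemaspaandraThierauf1997, Lemma 3.9] [cite: Sipser1983, Coding Lemma] -/
theorem hashable_of_card_le {X : Finset (Fin M → Bool)} (hX : 2 * X.card ≤ 2 ^ k) : Hashable X k :=
  exists_separates X hX

/-- **Failure of `Hash_X(ℓ)` bounds `|X|` from below**: `2^ℓ < 2·|X|` (contrapositive of the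
Coding Lemma). [cite: HanHemaspaandraThierauf1997, Cor. 3.10] -/
theorem two_pow_lt_of_not_hashable {X : Finset (Fin M → Bool)} {ℓ : ℕ} (h : ¬ Hashable X ℓ) :
    2 ^ ℓ < 2 * X.card :=
  Nat.lt_of_not_le fun hle => h (hashable_of_card_le hle)

/-- **HHT Cor. 3.10, both bounds**: if `Hash_X(ℓ)` holds and `Hash_X(ℓ')` fails then
`2^{ℓ'} < 2·|X| ≤ 2ℓ·2^ℓ` (with `ℓ' = ℓ - 1` for the least `ℓ`: `2^{ℓ-2} < |X| ≤ ℓ·2^ℓ`).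
[cite: HanHemaspaandraThierauf1997, Cor. 3.10] -/
theorem bounds_of_hashable_of_not {X : Finset (Fin M → Bool)} {ℓ ℓ' : ℕ} (h : Hashable X ℓ)
    (h' : ¬ Hashable X ℓ') : 2 ^ ℓ' < 2 * X.card ∧ X.card ≤ ℓ * 2 ^ ℓ :=
  ⟨two_pow_lt_of_not_hashable h', card_le_of_hashable h⟩

/-! ### The skolemised form of `Separate` and the parity reading of `H z ≠ H y` -/

/-- The matrix of the skolemised separation predicate: for a candidate `y` and one challenger `Z i`
per matrix, "if `y ∈ X` then for some `i`, the challenger `Z i` (if in `X` and different from `y`)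
is told apart from `y` by `Hᵢ`". [HHT 1997, proof of Thm. 3.11 ("Separate is a coNP predicate")]
[cite: HanHemaspaandraThierauf1997, Thm. 3.11 (proof)] -/
def SepMatrix (X : Finset (Fin M → Bool)) (H : Fin k → Fin k → Fin M → Bool) (y : Fin M → Bool)
    (Z : Fin k → Fin M → Bool) : Prop :=
  y ∈ X → ∃ i, (Z i ∈ X → Z i ≠ y → hashVal (H i) (Z i) ≠ hashVal (H i) y)

/-- **Skolemisation**: `Separate_X(H) ↔ ∀ y ∀ (Z₁,…,Z_k), SepMatrix` — the bounded `∃ i` commutes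
with the universal quantifier over challengers at the price of one challenger per index.
[HHT 1997, proof of Thm. 3.11] [cite: HanHemaspaandraThierauf1997, Thm. 3.11 (proof)] -/
theorem separates_iff_forall {X : Finset (Fin M → Bool)} {H : Fin k → Fin k → Fin M → Bool} :
    Separates X H ↔ ∀ (y : Fin M → Bool) (Z : Fin k → Fin M → Bool), SepMatrix X H y Z := by
  constructor
  · intro hS y Z hy
    obtain ⟨i, hi⟩ := hS y hy
    exact ⟨i, fun hZ hne => hi (Z i) hZ hne⟩
  · intro h y hy
    by_contra hno
    simp only [not_exists, Isolates, not_forall, exists_prop, not_not] at hno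
    choose Z hZX hZne hZeq using hno
    obtain ⟨i, hi⟩ := h y Z hy
    exact hi (hZX i) (hZne i) (hZeq i)

/-- In `GF(2)`: `⟨r, z⟩ + ⟨r, y⟩ = #{c | r_c ∧ z_c ≠ y_c} (mod 2)`. [folklore] -/
theorem dotZ_add_dotZ (r z y : Fin M → Bool) :
    dotZ r z + dotZ r y = ((univ.filter fun c => r c = true ∧ z c ≠ y c).card : ZMod 2) := by
  classical
  rw [dotZ, dotZ, ← sum_add_distrib, ← Nat.cast_id (Finset.card _), ← sum_boole]
  push_cast
  refine sum_congr rfl fun c _ => ?_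
  have h11 : (1 : ZMod 2) + 1 = 0 := by decide
  cases r c <;> cases z c <;> cases y c <;> simp [h11]

/-- **The parity reading of distinct hash values**: `H z ≠ H y` iff for some row `ρ` the number of
positions `c` with `H_{ρc} = 1` and `z_c ≠ y_c` is odd. [HHT 1997, Def. 3.8 (arithmetic in GF(2))]
[cite: HanHemaspaandraThierauf1997, Def. 3.8] -/
theorem hashVal_ne_iff (H : Fin k → Fin M → Bool) (z y : Fin M → Bool) :
    hashVal H z ≠ hashVal H y ↔
      ∃ ρ, Odd (univ.filter fun c => H ρ c = true ∧ z c ≠ y c).card := by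
  classical
  rw [Ne, funext_iff, not_forall]
  refine exists_congr fun ρ => ?_
  change ¬ dotZ (H ρ) z = dotZ (H ρ) y ↔ _
  have hiff : dotZ (H ρ) z = dotZ (H ρ) y ↔ dotZ (H ρ) z + dotZ (H ρ) y = 0 := by
    generalize dotZ (H ρ) z = a, dotZ (H ρ) y = b
    revert a b; decide
  rw [hiff, dotZ_add_dotZ, ZMod.natCast_eq_zero_iff_even, Nat.not_even_iff_odd]

end SipserHash

end Literature.Computability.Complexity
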